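import Summits.HubbardSuperconductivity.HubbardSuperconductivity.Theorems.AnisotropyChordTransferFibre3SideCondCellT
import Summits.HubbardSuperconductivity.HubbardSuperconductivity.Theorems.AnisotropyChordTransferFibre3N1RowCellSoundTA

/-!
# Route `AnisotropyChord` / H0 rotor rung, LEVEL 2 SIDE CONDITIONS on the t-BLOCKS: the CHECKER-AGNOSTIC twins (`…TA`)
★ `finalVec_mem_of_cellFinalBoxTA`, ★★ `hreg_of_sideCheckTA`

`…SideCondCellT` states the block side-cell certificate (`sideCellCheckT`, `L ≥ 48`) with `(hc : c.check = true)`; here the same two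
theorems with the checker-agnostic admissibility `(hc : c.Adm)` of `…L2TCellR` (fed by `TCell.adm_of_check` / `adm_of_checkR` — ASK 3,
ring-sharpened brackets), proofs verbatim with `pmem_xTrueTA`.  The program `sideCellCheckT` and the numeric lemmas are reused unchanged.
Prover seat `hubbard-h0-rotor-p2` g8; helper for piece A = stmt-HubbardSuperconductivity-23918 of rung 19089 (`--supports`, helper class).
WHAT THIS IS NOT: nothing here proves superconductivity in the Hubbard model; side-condition plumbing of ONE conditional reduction (the GM₃
∀L certificate) on t-blocks.  Mathlib + the tree only; no sorry.
-/

set_option linter.dupNamespace false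
set_option autoImplicit false

open Literature.Analysis.ValidatedNumerics

namespace Summit.HubbardSuperconductivity.HubbardSuperconductivity.Theorems.AnisotropyChord.Transfer.Fibre3

namespace RowC

open L2 L2.N1

noncomputable section

variable (L : ℕ) [NeZero L]

/-- ★ for a ground profile located in the block cell (`c.L₀ ≤ L ≤ c.L₁`, `16 ≤ L`) and a successful `cellFinalBoxCB`, the final
vector of the true data lies in the final box, with coordinates `y₀ = t`, `y₁ = π²`, `y₂ = ν`, `y₃ = a`, `y₄ = ê₁`,
`y₆ = P̂ = t³ΣF₂³`, `y₈ = Q̂₁ = t²Σ n_K F₂` (verbatim `finalVec_mem_of_cellFinalBoxC` with the block box bridge). [folklore] -/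
theorem finalVec_mem_of_cellFinalBoxTA (c : L2.TCell) (a1 a2 : ℚ) (pi : ℕ × ℕ) {F : Box}
    (hF : cellFinalBoxCB (c.box a1 a2) 2 pi = some F) (hc : c.Adm) (h16 : 16 ≤ L) (hL : c.L0 ≤ L)
    (hL1 : c.L1 = 0 ∨ L ≤ c.L1)
    {Δ lam2 : ℝ} {f : Tor L → ℝ} (hΔ0 : 0 ≤ Δ) (hΔ1 : Δ < 1) (hf : IsGroundTwoMagnon L Δ lam2 f)
    (hν1 : (c.n1 : ℝ) / c.νd ≤ lam2 / (2 * Real.pi / L) ^ 2) (hν2 : lam2 / (2 * Real.pi / L) ^ 2 ≤ (c.n2 : ℝ) / c.νd)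
    (ha1 : ((a1 : ℚ) : ℝ) ≤ Δ * f (K1 L)) (ha2 : Δ * f (K1 L) ≤ ((a2 : ℚ) : ℝ)) :
    let t : ℝ := (2 * Real.pi / L) ^ 2
    ∃ y : ℕ → ℝ, F.mem y ∧ y 0 = t ∧ y 1 = Real.pi ^ 2 ∧ y 2 = lam2 / t ∧ y 3 = Δ * f (K1 L) ∧ y 4 = eps1 L / t ∧
      y 6 = t ^ 3 * ∑ k : Tor L, F2 L f k ^ 3 ∧ y 8 = t ^ 2 * ∑ k : Tor L, nK L f k * F2 L f k := by
  classical
  intro t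
  set X := xTrue L Δ lam2 f (Δ * f (K1 L)) with hXdef
  have hLpos : (0 : ℝ) < L := by exact_mod_cast (show 0 < L by omega)
  have hπ := Real.pi_pos
  have ht0 : 0 < t := by positivity
  -- regime facts (no `L ≥ 128` input, as in `trialGap_of_coreBoundT`)
  have hlam : 0 < lam2 := lam2_pos L (by omega) hΔ1 hf.1
  have h2 : 2 * lam2 < eps1 L := two_lam2_lt_eps1 L (by omega) hΔ0 hf
  have ha0 : 0 ≤ Δ * f (K1 L) := mul_nonneg hΔ0 (le_of_lt hf.1.2.2.1)
  have hν4 : lam2 / (2 * Real.pi / L) ^ 2 < 4 / Real.pi ^ 2 := by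
    have hε := RateLemma.eps1_le_half_theta_sq L
    rw [div_lt_div_iff₀ ht0 (by positivity)]
    have hπ2 : Real.pi ^ 2 < 16 := by nlinarith [Real.pi_lt_d2, Real.pi_pos]
    nlinarith
  obtain ⟨_, d2, _, _, d5, _, _⟩ := ManifoldA.manifold_dictionary L (by omega) hΔ0 hΔ1 hf
  have hu : 0 < cS L Δ lam2 f * Gzero L lam2 := by
    have hη : 0 < etaEff L lam2 := by unfold etaEff; positivity
    have hcS : 0 < cS L Δ lam2 f := by rw [d2]; positivity
    exact mul_pos hcS (Gzero_pos_of_lt L (by omega) (by linarith))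
  have hV1 : (1 : ℝ) / (L : ℝ) ^ 2 = t * (4 * Real.pi ^ 2)⁻¹ := by
    show (1 : ℝ) / (L : ℝ) ^ 2 = (2 * Real.pi / L) ^ 2 * (4 * Real.pi ^ 2)⁻¹
    field_simp; ring
  have hu' : 0 < 1 - Δ * f (K1 L) + Δ * f (K1 L) * ((2 * Real.pi / L) ^ 2 * (4 * Real.pi ^ 2)⁻¹) := by
    have e : 1 - Δ * f (K1 L) + Δ * f (K1 L) * ((2 * Real.pi / L) ^ 2 * (4 * Real.pi ^ 2)⁻¹)
        = 1 - Δ * f (K1 L) + Δ * f (K1 L) / (L : ℝ) ^ 2 := by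
      have : (2 * Real.pi / (L : ℝ)) ^ 2 * (4 * Real.pi ^ 2)⁻¹ = 1 / (L : ℝ) ^ 2 := hV1.symm
      rw [this]; ring
    rw [e, ← d5, Gres_zero_zero_eq_Gzero]; exact hu
  -- the interval layer of p2 on the block box
  have hPM : PMem (c.box a1 a2) X := pmem_xTrueTA L c hc a1 a2 hL hL1 Δ lam2 f _ hν1 hν2 ha1 ha2
  have hsp := xTrue_specs_ground L Δ lam2 f (by omega) hΔ0 hΔ1 hf hlam h2 hν4 ha0 hu'
  set vP : ℝ := t ^ 3 * ∑ k : Tor L, F2 L f k ^ 3 with hvP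
  set vQ : ℝ := t ^ 2 * ∑ k : Tor L, nK L f k * F2 L f k with hvQ
  set vB : ℝ := ((2 * Real.pi / L) ^ 2) ^ 3 * ∑ k : Tor L, F2 L f k ^ 2 * F2 L f (k + K1 L) with hvB
  set vA : ℝ := ((2 * Real.pi / L) ^ 2) ^ 2 * ∑ k : Tor L, F2 L f k ^ 2 * cosx L k with hvA
  set vJ : ℝ := ((2 * Real.pi / L) ^ 2) ^ 2 * ∑ k : Tor L, bcJ L f k with hvJ
  have oB := bHat_mem L Δ lam2 f (by omega) hΔ0 hΔ1 hf hlam h2 hu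
  have oP := pHat_mem L Δ lam2 f (by omega) hΔ0 hΔ1 hf hlam h2 hu
  have oA := aHat_mem L Δ lam2 f (by omega) hΔ0 hΔ1 hf hlam h2 hu
  have oQ := q1Hat_mem L Δ lam2 f (by omega) hΔ0 hΔ1 hf hlam h2 hu
  have oJ := j1Hat_mem L Δ lam2 f (by omega) hΔ0 hΔ1 hf hlam h2 hu
  have hob : ∀ j (hj : j < (objSpecsC 2).length) (hj' : j < [vB, vP, vA, vQ, vJ].length),
      ((objSpecsC 2)[j].1).eval X ≤ [vB, vP, vA, vQ, vJ][j] ∧ [vB, vP, vA, vQ, vJ][j] ≤ ((objSpecsC 2)[j].2).eval X := by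
    intro j hj hj'
    have hj5 : j < 5 := by simpa [objSpecsC] using hj
    interval_cases j
    · simpa [objSpecsC] using oB
    · simpa [objSpecsC] using oP
    · simpa [objSpecsC] using oA
    · simpa [objSpecsC] using oQ
    · simpa [objSpecsC] using oJ
  have hlen0 : (c.box a1 a2).length = 16 := c.box_length a1 a2
  have hv := specsVarsOkC_two
  simp only [specsVarsOkC, Bool.and_eq_true] at hv
  obtain ⟨hv1, hv2⟩ := hv
  have hS : SpecsHold X (c.box a1 a2).length (specs 2) := by
    rw [hlen0]; exact specsHold_of X (specs 2) 16 hv1 hsp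
  unfold cellFinalBoxCB cellBoxB at hF
  split at hF
  · exact absurd hF (by simp)
  · rename_i B hB
    split at hF
    · exact absurd hF (by simp)
    · rename_i objs hobjs
      simp only [Option.some.injEq] at hF
      subst hF
      obtain ⟨hPB, hlenB⟩ := extendBox_sound pi.1 pi.2 X (specs 2) _ B hB hPM hS
      have hO : ObjsHold X B.length (objSpecsC 2) [vB, vP, vA, vQ, vJ] := by
        rw [hlenB, hlen0]
        exact objsHold_of X _ (objSpecsC 2) [vB, vP, vA, vQ, vJ] (by simp [objSpecsC]) hv2 hob
      have hbr := encloseObjs_sound pi.1 pi.2 hPB (objSpecsC 2) [vB, vP, vA, vQ, vJ] objs hobjs hO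
      have hmem := finalBox_mem hPB (by
        rw [hlenB, hlen0]
        simp only [specs, List.length_append, List.length_cons, List.length_nil, List.length_map]
        omega) hbr
      obtain ⟨y0, y1, y2, y3, y4, y5, y6, y7, y8, y9⟩ := finalVec_vals X vB vP vA vQ vJ
      have hX0 : X 0 = t := xTrue_zero L Δ lam2 f _
      have hX1 : X 1 = Real.pi ^ 2 := by rw [hXdef, xTrue_lt16 L Δ lam2 f _ (by norm_num)]; rfl
      have hX2 : X 2 = lam2 / t := by rw [hXdef, xTrue_lt16 L Δ lam2 f _ (by norm_num)]; rfl
      have hX3 : X 3 = Δ * f (K1 L) := by rw [hXdef, xTrue_lt16 L Δ lam2 f _ (by norm_num)]; rfl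
      have hX16 : X 16 = eps1 L / t := by rw [hXdef, xTrue_16]; rfl
      refine ⟨finalVec X [vB, vP, vA, vQ, vJ], hmem, ?_, ?_, ?_, ?_, ?_, ?_, ?_⟩
      · rw [y0, hX0]
      · rw [y1, hX1]
      · rw [y2, hX2]
      · rw [y3, hX3]
      · rw [y4, hX16]
      · rw [y6]
      · rw [y8]

/-- ★★ **A PASSING BLOCK SIDE-CONDITION CHECK GIVES THE REGIME CLAUSE OF `gm3_of_cell` FOR EVERY `L` OF THE BLOCK ON THE
CELL** (`c.L₀ ≤ L`, `L ≤ c.L₁` unless `c.L₁ = 0`, `48 ≤ L`): `0 ≤ mHole` and `facMI·η_eff·(a_D + b/(2 + cos θ)) < c`. -/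
theorem hreg_of_sideCheckTA (c : L2.TCell) (a1 a2 aD b cc : ℚ) (pi : ℕ × ℕ)
    (hchk : sideCellCheckT c a1 a2 aD b cc pi = true) (hc : c.Adm) (h48 : 48 ≤ L) (hL : c.L0 ≤ L)
    (hL1 : c.L1 = 0 ∨ L ≤ c.L1)
    {Δ lam2 : ℝ} {f : Tor L → ℝ} (hΔ0 : 0 ≤ Δ) (hΔ1 : Δ < 1) (hf : IsGroundTwoMagnon L Δ lam2 f)
    (hν1 : (c.n1 : ℝ) / c.νd ≤ lam2 / (2 * Real.pi / L) ^ 2) (hν2 : lam2 / (2 * Real.pi / L) ^ 2 ≤ (c.n2 : ℝ) / c.νd)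
    (ha1 : ((a1 : ℚ) : ℝ) ≤ Δ * f (K1 L)) (ha2 : Δ * f (K1 L) ≤ ((a2 : ℚ) : ℝ)) :
    0 ≤ mHole L Δ f ∧
      facMI L Δ f * etaEff L lam2 * ((aD : ℝ) + (b : ℝ) / (2 + Real.cos (2 * Real.pi / L))) < (cc : ℝ) := by
  have hLpos : (0 : ℝ) < L := by exact_mod_cast (show 0 < L by omega)
  have hπ := Real.pi_pos
  have hL2 : 2 ≤ L := by omega
  set t : ℝ := (2 * Real.pi / L) ^ 2 with ht
  have ht0 : 0 < t := by positivity
  -- unpack the check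
  unfold sideCellCheckT at hchk
  simp only [Bool.and_eq_true, decide_eq_true_eq] at hchk
  obtain ⟨⟨haD, hb⟩, hrest⟩ := hchk
  split at hrest
  · exact absurd hrest (by simp)
  · rename_i F hF
    simp only [Bool.and_eq_true] at hrest
    obtain ⟨⟨hP, hM⟩, hS⟩ := hrest
    obtain ⟨y, hmem, g0, g1, g2, g3, g4, g6, g8⟩ :=
      finalVec_mem_of_cellFinalBoxTA L c a1 a2 pi hF hc (by omega) hL hL1 hΔ0 hΔ1 hf hν1 hν2 ha1 ha2
    rw [← ht] at g0 g2 g4 g6 g8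
    set vP : ℝ := t ^ 3 * ∑ k : Tor L, F2 L f k ^ 3 with hvP
    set vQ : ℝ := t ^ 2 * ∑ k : Tor L, nK L f k * F2 L f k with hvQ
    have eP := rexprLeOn_sound hP _ hmem
    have eM := rexprLeOn_sound hM _ hmem
    have eS := rexprLeOn_sound hS _ hmem
    simp only [yP, RExpr.eval] at eP
    rw [eval_mholeET] at eM
    rw [eval_sideE y g1] at eS
    rw [g6] at eP
    rw [g2, g4, g6, g8] at eM
    rw [g2, g3, g4, g6, g8] at eS
    push_cast at eP eM eS
    have hvP0 : 0 < vP := by linarith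
    -- `T⁺ = t·τ`
    have hT := Tplus_eq_tau L hL2 hf (by rw [← ht]; exact hvP0)
    rw [← ht] at hT
    set τ : ℝ := 3 * (lam2 / t) - 3 / 2 * vQ * vP⁻¹ with hτ
    have hTt : Tplus L Δ f = t * τ := by rw [hT]
    have hε := eps1_pos L (by omega)
    have hεt : eps1 L = t * (eps1 L / t) := by field_simp
    -- the hole margin
    have hm : 0 ≤ mHole L Δ f := by
      apply mHole_nonneg_of_Tplus_le48 L h48
      rw [hTt]
      have : t * τ ≤ t * (498 / 1000 * (eps1 L / t)) := mul_le_mul_of_nonneg_left (by linarith) ht0.le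
      calc t * τ ≤ t * (498 / 1000 * (eps1 L / t)) := this
        _ = 0.498 * eps1 L := by field_simp; ring
    refine ⟨hm, ?_⟩
    -- the factor
    have hfac := facMI_mul_etaEff_le L (by omega) hΔ0 hΔ1 hf.1 hm
    have hTlt := Tplus_lt_of_mHole_nonneg L (by omega) hm
    have hden : 0 < 2 * eps1 L - t * τ := by rw [← hTt]; linarith
    have ht0' : t ≠ 0 := ht0.ne'
    have hκ : 3 * (eps1 L / t) * (2 * (eps1 L / t) - τ)⁻¹ = kappaE L Δ f := by
      unfold kappaE
      rw [hTt]
      have e : 2 * (eps1 L / t) - τ = (2 * eps1 L - t * τ) / t := by field_simp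
      rw [e, inv_div]
      field_simp
    obtain ⟨_, _, _, _, _, _, d7⟩ := ManifoldA.manifold_dictionary L (by omega) hΔ0 hΔ1 hf
    rw [← ht] at d7
    set A : ℝ := Real.pi ^ 2 * (lam2 / t) + 3 * (eps1 L / t) * (2 * (eps1 L / t) - τ)⁻¹ * (Δ * f (K1 L)) with hA
    have hfacA : facMI L Δ f * etaEff L lam2 ≤ A := by rw [hA, hκ, ← d7]; exact hfac
    have hρ := two_add_cos_ge48 L h48
    have hb0 : (0 : ℝ) ≤ (b : ℝ) := by exact_mod_cast hb
    have haD0 : (0 : ℝ) ≤ (aD : ℝ) := by exact_mod_cast haD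
    have hBq : (aD : ℝ) + (b : ℝ) / (2 + Real.cos (2 * Real.pi / L)) ≤ (aD : ℝ) + (b : ℝ) * (100 / 299) := by
      have h1 : (b : ℝ) / (2 + Real.cos (2 * Real.pi / L)) ≤ (b : ℝ) / 2.99 :=
        div_le_div_of_nonneg_left hb0 (by norm_num) hρ
      have e : (b : ℝ) / 2.99 = (b : ℝ) * (100 / 299) := by ring
      linarith
    have hB0 : 0 ≤ (aD : ℝ) + (b : ℝ) / (2 + Real.cos (2 * Real.pi / L)) :=
      add_nonneg haD0 (div_nonneg hb0 (by linarith))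
    have hlam : 0 < lam2 := lam2_pos L (by omega) hΔ1 hf.1
    have hfac0 : 0 ≤ facMI L Δ f * etaEff L lam2 := by
      have hη : 0 < etaEff L lam2 := by unfold etaEff; positivity
      have hκ0 : 0 ≤ kappaE L Δ f := by
        unfold kappaE; exact div_nonneg (by linarith) (by linarith)
      have hg0 : 0 < g0hat L Δ f := by have := g0hat_ge L hΔ0 hm; linarith
      have : 0 ≤ facMI L Δ f := by unfold facMI; positivity
      positivity
    have hA0 : 0 ≤ A := le_trans hfac0 hfacA
    calc facMI L Δ f * etaEff L lam2 * ((aD : ℝ) + (b : ℝ) / (2 + Real.cos (2 * Real.pi / L)))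
        ≤ A * ((aD : ℝ) + (b : ℝ) / (2 + Real.cos (2 * Real.pi / L))) := mul_le_mul_of_nonneg_right hfacA hB0
      _ ≤ A * ((aD : ℝ) + (b : ℝ) * (100 / 299)) := mul_le_mul_of_nonneg_left hBq hA0
      _ < (cc : ℝ) := by rw [hA]; linarith

end

end RowC

end Summit.HubbardSuperconductivity.HubbardSuperconductivity.Theorems.AnisotropyChord.Transfer.Fibre3
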